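import Summits.QuantumFields.YangMills.Theses.PencilRigidity
import Literature.NumberTheory.LFunctions.PowerOscillatoryIntegrals

/-!
# The planar threshold `σ = 8` is sharp (I) — negative knowledge for crux `PencilRigidity.ShellRigidity`
# (stmt-QuantumFields-11685, route PencilRigidity; refuter lineage `cdisprove`, cycle 2)

The picked line `transverse-smearing-planar-threshold` reduces the crux to PLANAR statements about
`D₄`-symmetric kernels `F : ℝ² → ℝ` of order `σ` (`|F x| ≤ C(1 + |x|^{-σ})`). Its registered stub
`stub_planarAngularRigidity` says: two-chart (axis and diagonal) Laplace–Fourier representations by finite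
measures carried by the forward light cone force `F` to be radial when `0 < σ < 8`. This file proves that
`σ < 8` cannot be relaxed to `σ ≤ 8` (`not_planarAngularRigidityLe8`), by one explicit witness:

* `F8` — `F₈(t,s) = Re ((t + is)⁸)⁻¹ = cos(8φ)/r⁸`: `D₄`-symmetric (`F8_symm`), continuous off `0`
  (`continuousOn_F8`), of order exactly `8` with constant `1` (`abs_F8_le`), not radial
  (`F8_one_zero`, `F8_dir_pi_div_eight`: value `−1` at angle `π/8`);
* `mu8 ε` — the finite measures `½·p⁷e^{-εp}/7!·dp` on the two boundary rays `p₁ = ±p₀` of the forward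
  light cone (`mu8_neg0`, `mu8_cone`, `isFiniteMeasure_mu8`), representing `F₈` in the axis chart
  (`integral_mu8`, `F8_axisRep`: `F₈(ε+t,b) = ∫e^{-tp₀+ibp₁}dμ_ε`, via `∫₀^∞u⁷e^{-ru}du = 7!/r⁸`,
  `Re r > 0`) AND in the diagonal chart with the same measure (`F8_diagRep`, since `F₈ ∘ L = F₈` for the
  light-cone involution, `F8_diag`).

So the one quantitative threshold of the line (Fourier modes `e^{4inα}` of the angular function die iff
`4|n| > σ`) is attained by the modes `n = ±2` exactly at `σ = 8` — the planar shadow of the crux's `η > 0`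
(`(Σ∂_μ⁴)²G_m ∼ |x|⁻¹⁰` smears to order `8`). Companion file `PlanarPointwiseSharp.lean`: the same witness
is POINTWISE four-mirror positive, so the ideas' transfer target `C⁺ = PlanarShellRigidity` is sharp too.
No Theses declaration is asserted positively.
-/

namespace Summit.QuantumFields.YangMills.Theorems.ShellRigidity.Negative

open scoped BigOperators ComplexConjugate NNReal ENNReal
open MeasureTheory Complex Set

noncomputable section

local notation "E4" => EuclideanSpace ℝ (Fin 4)

/-! ## The witness `F₈ = Re (t + i s)⁻⁸` and its elementary properties -/

/-- The sharp planar witness `F₈(t,s) = Re ((t + is)⁸)⁻¹ = cos (8φ) / r⁸`. -/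
def F8 (x : ℝ × ℝ) : ℝ := ((((x.1 : ℂ) + x.2 * I) ^ 8)⁻¹).re

/-- `I⁸ = 1`. [folklore] -/
theorem I_pow_eight : (I : ℂ) ^ 8 = 1 := by
  have : (I : ℂ) ^ 8 = (I ^ 2) ^ 4 := by ring
  rw [this, I_sq]; norm_num

/-- `F₈` is invariant under the swap `(t,s) ↦ (s,t)` (`s + it = i·conj(t + is)`, `i⁸ = 1`). [folklore] -/
theorem F8_swap (t s : ℝ) : F8 (s, t) = F8 (t, s) := by
  have h : ((s : ℂ) + t * I) = I * conj ((t : ℂ) + s * I) := by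
    apply Complex.ext <;> simp
  show ((((s : ℂ) + t * I) ^ 8)⁻¹).re = ((((t : ℂ) + s * I) ^ 8)⁻¹).re
  rw [h, mul_pow, I_pow_eight, one_mul, ← map_pow, ← map_inv₀, conj_re]

/-- `F₈` is even in the second variable (complex conjugation). [folklore] -/
theorem F8_neg_snd (t s : ℝ) : F8 (t, -s) = F8 (t, s) := by
  have h : ((t : ℂ) + ((-s : ℝ) : ℂ) * I) = conj ((t : ℂ) + s * I) := by
    apply Complex.ext <;> simp
  show ((((t : ℂ) + ((-s : ℝ) : ℂ) * I) ^ 8)⁻¹).re = ((((t : ℂ) + s * I) ^ 8)⁻¹).re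
  rw [h, ← map_pow, ← map_inv₀, conj_re]

/-- `F₈` is even in the first variable (`−conj`, even power). [folklore] -/
theorem F8_neg_fst (t s : ℝ) : F8 (-t, s) = F8 (t, s) := by
  have h : (((-t : ℝ) : ℂ) + s * I) = -conj ((t : ℂ) + s * I) := by
    apply Complex.ext <;> simp
  show (((((-t : ℝ) : ℂ) + s * I) ^ 8)⁻¹).re = ((((t : ℂ) + s * I) ^ 8)⁻¹).re
  rw [h, Even.neg_pow (by decide), ← map_pow, ← map_inv₀, conj_re]

/-- The `D₄` symmetry clause of the stub, for `F₈`. [folklore] -/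
theorem F8_symm (t s : ℝ) : F8 (t, s) = F8 (s, t) ∧ F8 (t, s) = F8 (t, -s) ∧ F8 (t, s) = F8 (-t, s) :=
  ⟨(F8_swap s t).symm ▸ (F8_swap s t) ▸ rfl, (F8_neg_snd t s).symm, (F8_neg_fst t s).symm⟩

/-- The light-cone chart: `F₈((T+v)/√2, (T-v)/√2) = F₈(T, v)` (`e^{iπ/4}` to the 8th power is `1`). -/
theorem F8_diag (T v : ℝ) : F8 ((T + v) / Real.sqrt 2, (T - v) / Real.sqrt 2) = F8 (T, v) := by
  have hs : (Real.sqrt 2)⁻¹ = Real.sqrt 2 / 2 := Real.sqrt_div_self.symm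
  have hz : ((((T + v) / Real.sqrt 2 : ℝ)) : ℂ) + (((T - v) / Real.sqrt 2 : ℝ) : ℂ) * I
      = ((1 / Real.sqrt 2 : ℝ) : ℂ) * ((1 + I) * conj ((T : ℂ) + v * I)) := by
    apply Complex.ext
    · simp; rw [← hs]; ring
    · simp; rw [← hs]; ring
  have hc : (((1 / Real.sqrt 2 : ℝ) : ℂ)) ^ 8 = 1 / 16 := by
    rw [← Complex.ofReal_pow, one_div, inv_pow, show (8:ℕ) = 2 * 4 from rfl, pow_mul,
      Real.sq_sqrt two_pos.le]
    norm_num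
  have hI4 : (I : ℂ) ^ 4 = 1 := by
    rw [show (I : ℂ) ^ 4 = (I ^ 2) ^ 2 by ring, I_sq]; norm_num
  have h16 : (1 + I) ^ 8 = (16 : ℂ) := by
    have h2 : (1 + I) ^ 2 = 2 * I := by rw [add_sq, I_sq]; ring
    have : (1 + I) ^ 8 = ((1 + I) ^ 2) ^ 4 := by ring
    rw [this, h2, mul_pow, hI4]; norm_num
  show (((((((T + v) / Real.sqrt 2 : ℝ)) : ℂ) + (((T - v) / Real.sqrt 2 : ℝ) : ℂ) * I) ^ 8)⁻¹).re
      = ((((T : ℂ) + v * I) ^ 8)⁻¹).re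
  rw [hz, mul_pow, mul_pow, hc, h16, ← map_pow, ← mul_assoc, show (1 / 16 * 16 : ℂ) = 1 by norm_num,
    one_mul, ← map_inv₀, conj_re]

/-- `F₈` is continuous off the origin. [folklore] -/
theorem continuousOn_F8 : ContinuousOn F8 {x | x ≠ 0} := by
  intro x hx
  apply ContinuousAt.continuousWithinAt
  have hz : ((x.1 : ℂ) + x.2 * I) ≠ 0 := by
    intro h0
    apply hx
    have h1 := congrArg Complex.re h0
    have h2 := congrArg Complex.im h0
    simp at h1 h2
    exact Prod.ext h1 h2
  have hz8 : ((x.1 : ℂ) + x.2 * I) ^ 8 ≠ 0 := pow_ne_zero _ hz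
  have hcz : Continuous fun y : ℝ × ℝ => ((y.1 : ℂ) + y.2 * I) ^ 8 := by fun_prop
  exact Complex.continuous_re.continuousAt.comp (hcz.continuousAt.inv₀ hz8)

/-- The order clause with `σ = 8`, `C = 1`: `|F₈ x| ≤ |x|⁻⁸ ≤ 1·(1 + (x₁²+x₂²)^{-8/2})`. [folklore] -/
theorem abs_F8_le (x : ℝ × ℝ) (hx : x ≠ 0) :
    |F8 x| ≤ 1 * (1 + (x.1 ^ 2 + x.2 ^ 2) ^ (-((8 : ℝ) / 2))) := by
  have hr : 0 < x.1 ^ 2 + x.2 ^ 2 := by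
    rcases lt_or_ge 0 (x.1 ^ 2 + x.2 ^ 2) with hlt | hle
    · exact hlt
    · exfalso
      apply hx
      have h1 : x.1 ^ 2 = 0 := by nlinarith [sq_nonneg x.1, sq_nonneg x.2]
      have h2 : x.2 ^ 2 = 0 := by nlinarith [sq_nonneg x.1, sq_nonneg x.2]
      exact Prod.ext (pow_eq_zero_iff (n := 2) (by norm_num) |>.1 h1)
        (pow_eq_zero_iff (n := 2) (by norm_num) |>.1 h2)
  have hnorm : ‖(x.1 : ℂ) + x.2 * I‖ ^ 2 = x.1 ^ 2 + x.2 ^ 2 := by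
    rw [← Complex.normSq_eq_norm_sq, Complex.normSq_add_mul_I]
  have h1 : |F8 x| ≤ ‖(((x.1 : ℂ) + x.2 * I) ^ 8)⁻¹‖ := Complex.abs_re_le_norm _
  have h2 : ‖(((x.1 : ℂ) + x.2 * I) ^ 8)⁻¹‖ = (x.1 ^ 2 + x.2 ^ 2) ^ (-((8 : ℝ) / 2)) := by
    rw [norm_inv, norm_pow]
    have : ‖(x.1 : ℂ) + x.2 * I‖ ^ 8 = (x.1 ^ 2 + x.2 ^ 2) ^ (4 : ℕ) := by rw [← hnorm]; ring
    rw [this, show (-((8 : ℝ) / 2)) = -((4 : ℕ) : ℝ) by norm_num, Real.rpow_neg hr.le,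
      Real.rpow_natCast]
  have h3 : (0 : ℝ) ≤ (x.1 ^ 2 + x.2 ^ 2) ^ (-((8 : ℝ) / 2)) := Real.rpow_nonneg hr.le _
  linarith

/-- `F₈(1,0) = 1`. [folklore] -/
theorem F8_one_zero : F8 (1, 0) = 1 := by
  simp [F8]

/-- `F₈` at angle `π/8` on the unit circle is `cos π = −1`. [folklore] -/
theorem F8_dir_pi_div_eight : F8 (1 * Real.cos (Real.pi / 8), 1 * Real.sin (Real.pi / 8)) = -1 := by
  have hz : (((1 * Real.cos (Real.pi / 8) : ℝ)) : ℂ) + ((1 * Real.sin (Real.pi / 8) : ℝ) : ℂ) * I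
      = cexp ((Real.pi / 8 : ℝ) * I) := by
    rw [Complex.exp_mul_I]; push_cast; ring
  show (((((1 * Real.cos (Real.pi / 8) : ℝ) : ℂ) + ((1 * Real.sin (Real.pi / 8) : ℝ) : ℂ) * I) ^ 8)⁻¹).re
      = -1
  rw [hz, ← Complex.exp_nat_mul]
  have : ((8 : ℕ) : ℂ) * (((Real.pi / 8 : ℝ)) * I) = Real.pi * I := by push_cast; ring
  rw [this, Complex.exp_pi_mul_I]
  norm_num

/-! ## The boundary-ray measures `μ_ε` and the Laplace–Fourier representation of `F₈` -/

/-- Density `p⁷ e^{-εp} / (2·7!)` on the half-line. -/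
def dens8 (ε : ℝ) (p : ℝ) : ℝ≥0 := Real.toNNReal (p ^ 7 * Real.exp (-(ε * p)) / 10080)

/-- The density is measurable. [folklore] -/
theorem measurable_dens8 (ε : ℝ) : Measurable (dens8 ε) := by
  have : Continuous fun p : ℝ => p ^ 7 * Real.exp (-(ε * p)) / 10080 := by fun_prop
  exact this.measurable.real_toNNReal

/-- The radial measure `p⁷ e^{-εp} dp / (2·7!)` on `(0, ∞)`. -/
def rho8 (ε : ℝ) : Measure ℝ := (volume.restrict (Ioi (0 : ℝ))).withDensity fun p => dens8 ε p

/-- The two boundary rays `p ↦ (p, ±p, 0, 0)` of the forward light cone. -/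
def rayP (p : ℝ) : E4 := WithLp.toLp 2 ![p, p, 0, 0]
/-- See `rayP`. -/
def rayM (p : ℝ) : E4 := WithLp.toLp 2 ![p, -p, 0, 0]

/-- Time component on the ray `p₁ = p₀`. [folklore] -/
@[simp] theorem rayP_zero (p : ℝ) : rayP p 0 = p := by simp [rayP]
/-- Space component on the ray `p₁ = p₀`. [folklore] -/
@[simp] theorem rayP_one (p : ℝ) : rayP p 1 = p := by simp [rayP]
/-- Time component on the ray `p₁ = −p₀`. [folklore] -/
@[simp] theorem rayM_zero (p : ℝ) : rayM p 0 = p := by simp [rayM]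
/-- Space component on the ray `p₁ = −p₀`. [folklore] -/
@[simp] theorem rayM_one (p : ℝ) : rayM p 1 = -p := by simp [rayM]

/-- The ray maps are continuous. [folklore] -/
theorem continuous_rayP : Continuous rayP := by unfold rayP; fun_prop
/-- The ray maps are continuous. [folklore] -/
theorem continuous_rayM : Continuous rayM := by unfold rayM; fun_prop

/-- `μ_ε`: the measure `½ p⁷ e^{-εp}/7! dp` on each of the two boundary rays of the light cone. -/
def mu8 (ε : ℝ) : Measure E4 := (rho8 ε).map rayP + (rho8 ε).map rayM

/-- `p⁷e^{-εp}` is integrable on `(0,∞)` for `ε > 0`. [folklore] -/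
theorem integrableOn_dens8 {ε : ℝ} (hε : 0 < ε) :
    IntegrableOn (fun p : ℝ => p ^ 7 * Real.exp (-(ε * p)) / 10080) (Ioi 0) := by
  have h : IntegrableOn (fun u : ℝ => Real.exp (-(ε * u)) * u ^ ((7 : ℕ) : ℝ) / 10080) (Ioi 0) :=
    (Literature.NumberTheory.LFunctions.AFE.integrableOn_exp_neg_mul_mul_rpow hε
      (p := ((7 : ℕ) : ℝ)) (by norm_num)).div_const 10080
  refine h.congr_fun (fun p _ => ?_) measurableSet_Ioi
  simp only []
  rw [Real.rpow_natCast]; ring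

/-- `ρ_ε` is a finite measure (`ε > 0`). [folklore] -/
theorem isFiniteMeasure_rho8 {ε : ℝ} (hε : 0 < ε) : IsFiniteMeasure (rho8 ε) := by
  unfold rho8
  apply isFiniteMeasure_withDensity
  have hfi := (integrableOn_dens8 hε).hasFiniteIntegral
  rw [hasFiniteIntegral_iff_ofReal] at hfi
  · exact hfi.ne
  · filter_upwards [ae_restrict_mem measurableSet_Ioi] with p hp
    have hp : 0 < p := hp
    positivity

/-- `ρ_ε` does not charge `(−∞, 0]`. [folklore] -/
theorem rho8_Iic {ε : ℝ} : rho8 ε (Iic 0) = 0 := by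
  unfold rho8
  rw [withDensity_apply _ measurableSet_Iic, Measure.restrict_restrict measurableSet_Iic,
    Iic_inter_Ioi, Ioc_self, Measure.restrict_empty, lintegral_zero_measure]

/-- `ρ_ε`-almost every `p` is positive. [folklore] -/
theorem ae_rho8_pos (ε : ℝ) : ∀ᵐ p ∂(rho8 ε), 0 < p := by
  have h : ∀ᵐ p ∂(volume.restrict (Ioi (0:ℝ))), p ∈ Ioi (0:ℝ) := ae_restrict_mem measurableSet_Ioi
  exact (withDensity_absolutelyContinuous _ _).ae_le h

/-- `{p₀ < 0}` is measurable. [folklore] -/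
theorem measurableSet_neg0 : MeasurableSet {q : E4 | q 0 < 0} :=
  measurableSet_lt (by fun_prop) measurable_const

/-- `{p₀ < |p₁|}` (complement of the forward light cone) is measurable. [folklore] -/
theorem measurableSet_cone : MeasurableSet {q : E4 | q 0 < |q 1|} :=
  measurableSet_lt (by fun_prop) (by fun_prop)

/-- `μ_ε` is carried by `{p₀ ≥ 0}`. [folklore] -/
theorem mu8_neg0 (ε : ℝ) : mu8 ε {q : E4 | q 0 < 0} = 0 := by
  rw [mu8, Measure.add_apply, Measure.map_apply continuous_rayP.measurable measurableSet_neg0,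
    Measure.map_apply continuous_rayM.measurable measurableSet_neg0]
  have hP : rayP ⁻¹' {q : E4 | q 0 < 0} ⊆ Iic 0 := fun p hp => by
    simp only [mem_preimage, mem_setOf_eq, rayP_zero] at hp; exact le_of_lt hp
  have hM : rayM ⁻¹' {q : E4 | q 0 < 0} ⊆ Iic 0 := fun p hp => by
    simp only [mem_preimage, mem_setOf_eq, rayM_zero] at hp; exact le_of_lt hp
  rw [measure_mono_null hP rho8_Iic, measure_mono_null hM rho8_Iic, add_zero]

/-- `μ_ε` is carried by the forward light cone `{p₀ ≥ |p₁|}`. [folklore] -/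
theorem mu8_cone (ε : ℝ) : mu8 ε {q : E4 | q 0 < |q 1|} = 0 := by
  rw [mu8, Measure.add_apply, Measure.map_apply continuous_rayP.measurable measurableSet_cone,
    Measure.map_apply continuous_rayM.measurable measurableSet_cone]
  have hP : rayP ⁻¹' {q : E4 | q 0 < |q 1|} ⊆ Iic 0 := fun p hp => by
    simp only [mem_preimage, mem_setOf_eq, rayP_zero, rayP_one] at hp
    rcases le_or_gt p 0 with h | h
    · exact h
    · rw [abs_of_pos h] at hp
      exact absurd hp (lt_irrefl _)
  have hM : rayM ⁻¹' {q : E4 | q 0 < |q 1|} ⊆ Iic 0 := fun p hp => by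
    simp only [mem_preimage, mem_setOf_eq, rayM_zero, rayM_one] at hp
    rw [abs_neg] at hp
    rcases le_or_gt p 0 with h | h
    · exact h
    · rw [abs_of_pos h] at hp
      exact absurd hp (lt_irrefl _)
  rw [measure_mono_null hP rho8_Iic, measure_mono_null hM rho8_Iic, add_zero]

/-- `μ_ε` is finite (`ε > 0`). [folklore] -/
theorem isFiniteMeasure_mu8 {ε : ℝ} (hε : 0 < ε) : IsFiniteMeasure (mu8 ε) := by
  haveI := isFiniteMeasure_rho8 hε
  unfold mu8
  infer_instance

/-- `Γ(8) = 7! = 5040`. [folklore] -/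
theorem Gamma_eight : Complex.Gamma 8 = 5040 := by
  rw [show (8 : ℂ) = (7 : ℕ) + 1 by norm_num, Complex.Gamma_nat_eq_factorial]
  norm_num [Nat.factorial]

/-- `∫_0^∞ p⁷ e^{-εp}/(2·7!) · e^{-tp + i s b p} dp = ½ (ε + t - i s b)⁻⁸` along one ray
(`s = ±1`), from `∫_0^∞ u^{a-1} e^{-ru} du = Γ(a) r^{-a}`, `Re r > 0`. -/
theorem integral_ray {ε t : ℝ} (hεt : 0 < ε + t) (b s : ℝ) :
    ∫ p in Ioi (0:ℝ), (dens8 ε p) • cexp ((((-(t * p)) : ℝ) : ℂ) + ((b * (s * p) : ℝ) : ℂ) * I)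
      = (1 / 2 : ℂ) * (1 / ((((ε + t : ℝ)) : ℂ) - (s * b : ℝ) * I)) ^ 8 := by
  set r : ℂ := (((ε + t : ℝ)) : ℂ) - (s * b : ℝ) * I with hr
  have hre : 0 < r.re := by simp [hr]; linarith
  have hG := Literature.NumberTheory.LFunctions.AFE.integral_cpow_mul_exp_neg_mul_Ioi_complex
    (a := 8) (r := r) (by norm_num) hre
  have hG' : ∫ u in Ioi (0:ℝ), (u : ℂ) ^ 7 * cexp (-(r * u)) = (1 / r) ^ 8 * 5040 := by
    rw [← Gamma_eight]
    have h8 : (1 / r) ^ (8 : ℂ) = (1 / r) ^ (8 : ℕ) := by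
      rw [show (8 : ℂ) = ((8 : ℕ) : ℂ) by norm_num, Complex.cpow_natCast]
    rw [← h8, ← hG]
    refine setIntegral_congr_fun measurableSet_Ioi fun u _ => ?_
    rw [show (8 : ℂ) - 1 = ((7 : ℕ) : ℂ) by norm_num, Complex.cpow_natCast]
  have hpt : EqOn (fun p : ℝ => (dens8 ε p) • cexp ((((-(t * p)) : ℝ) : ℂ) + ((b * (s * p) : ℝ) : ℂ) * I))
      (fun p : ℝ => (1 / 10080 : ℂ) * ((p : ℂ) ^ 7 * cexp (-(r * p)))) (Ioi 0) := by
    intro p hp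
    have hp : 0 < p := hp
    simp only []
    rw [NNReal.smul_def, dens8, Real.coe_toNNReal _ (by positivity), Complex.real_smul]
    have hexp : ((Real.exp (-(ε * p)) : ℝ) : ℂ) * cexp ((((-(t * p)) : ℝ) : ℂ) + ((b * (s * p) : ℝ) : ℂ) * I)
        = cexp (-(r * p)) := by
      rw [Complex.ofReal_exp, ← Complex.exp_add]
      congr 1
      simp only [hr]; push_cast; ring
    rw [← hexp]; push_cast; ring
  rw [setIntegral_congr_fun measurableSet_Ioi hpt, integral_const_mul, hG']
  ring

/-- `F₈` as a complex number: `Re w = (w̄ + w)/2` with `w = ((E + ib)⁸)⁻¹`. -/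
theorem ofReal_F8 (E b : ℝ) : ((F8 (E, b) : ℝ) : ℂ)
    = (1 / 2 : ℂ) * (1 / ((E : ℂ) - b * I)) ^ 8 + (1 / 2 : ℂ) * (1 / ((E : ℂ) + b * I)) ^ 8 := by
  show ((((((E : ℂ) + b * I) ^ 8)⁻¹).re : ℝ) : ℂ) = _
  rw [Complex.re_eq_add_conj]
  simp only [map_inv₀, map_pow, map_add, map_mul, Complex.conj_ofReal, Complex.conj_I]
  have : (E : ℂ) + b * -I = E - b * I := by ring
  rw [this]
  field_simp
  ring

/-- **Laplace–Fourier representation of `F₈` by the cone-boundary measures `μ_ε`.** -/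
theorem integral_mu8 {ε : ℝ} (hε : 0 < ε) {t : ℝ} (ht : 0 ≤ t) (b : ℝ) :
    ∫ q, cexp ((((-(t * q 0)) : ℝ) : ℂ) + ((b * q 1 : ℝ) : ℂ) * I) ∂(mu8 ε)
      = ((F8 (ε + t, b) : ℝ) : ℂ) := by
  haveI := isFiniteMeasure_rho8 hε
  set f : E4 → ℂ := fun q => cexp ((((-(t * q 0)) : ℝ) : ℂ) + ((b * q 1 : ℝ) : ℂ) * I) with hf
  have hfc : Continuous f := by rw [hf]; fun_prop
  have hae := ae_rho8_pos ε
  -- integrability on the two rays (bounded by 1 a.e., finite measure)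
  have hint : ∀ (ray : ℝ → E4), Continuous ray → (∀ p, ray p 0 = p) →
      Integrable f ((rho8 ε).map ray) := by
    intro ray hray h0
    refine (integrable_map_measure hfc.aestronglyMeasurable hray.measurable.aemeasurable).2 ?_
    refine Integrable.of_bound (hfc.comp hray).aestronglyMeasurable 1 ?_
    filter_upwards [hae] with p hp
    simp only [Function.comp_apply, hf, Complex.norm_exp, h0]
    simp only [Complex.add_re, Complex.ofReal_re, Complex.mul_re, Complex.I_re, Complex.I_im,
      Complex.ofReal_im, mul_zero, zero_mul, sub_zero, add_zero, Real.exp_le_one_iff]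
    nlinarith
  rw [mu8, integral_add_measure (hint rayP continuous_rayP rayP_zero) (hint rayM continuous_rayM rayM_zero),
    integral_map continuous_rayP.measurable.aemeasurable hfc.aestronglyMeasurable,
    integral_map continuous_rayM.measurable.aemeasurable hfc.aestronglyMeasurable]
  simp only [hf, rayP_zero, rayP_one, rayM_zero, rayM_one]
  rw [rho8, integral_withDensity_eq_integral_smul (measurable_dens8 ε),
    integral_withDensity_eq_integral_smul (measurable_dens8 ε)]
  have hεt : 0 < ε + t := by linarith
  have hP := integral_ray hεt b 1
  have hM := integral_ray hεt b (-1)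
  simp only [one_mul] at hP
  have hM' : ∫ p in Ioi (0:ℝ), (dens8 ε p) • cexp ((((-(t * p)) : ℝ) : ℂ) + ((b * -p : ℝ) : ℂ) * I)
      = (1 / 2 : ℂ) * (1 / ((((ε + t : ℝ)) : ℂ) - ((-1) * b : ℝ) * I)) ^ 8 := by
    rw [← hM]
    refine setIntegral_congr_fun measurableSet_Ioi fun p _ => ?_
    simp only [neg_mul, one_mul, mul_neg]
  rw [hP, hM', ofReal_F8]
  have : (((ε + t : ℝ) : ℂ) - ((-1) * b : ℝ) * I) = ((ε + t : ℝ) : ℂ) + b * I := by push_cast; ring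
  rw [this]

/-- Axis-chart representation of `F₈` (hypothesis `hA` of the stub, verbatim shape). -/
theorem F8_axisRep : ∀ ε : ℝ, 0 < ε → ∃ μ : Measure (EuclideanSpace ℝ (Fin 4)), IsFiniteMeasure μ ∧
    μ {p | p 0 < 0} = 0 ∧ μ {p | p 0 < |p 1|} = 0 ∧
    ∀ t : ℝ, 0 ≤ t → ∀ b : ℝ, ((F8 (ε + t, b) : ℝ) : ℂ) =
      ∫ p, cexp ((((-(t * p 0) : ℝ)) : ℂ) + ((b * p 1 : ℝ) : ℂ) * I) ∂μ :=
  fun ε hε => ⟨mu8 ε, isFiniteMeasure_mu8 hε, mu8_neg0 ε, mu8_cone ε,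
    fun _ ht b => (integral_mu8 hε ht b).symm⟩

/-- Diagonal-chart representation of `F₈` (hypothesis `hD` of the stub, verbatim shape): the SAME
measures work, because `F₈ ∘ L = F₈` for the light-cone involution `L`. -/
theorem F8_diagRep : ∀ ε : ℝ, 0 < ε → ∃ μ : Measure (EuclideanSpace ℝ (Fin 4)), IsFiniteMeasure μ ∧
    μ {p | p 0 < 0} = 0 ∧ μ {p | p 0 < |p 1|} = 0 ∧
    ∀ u : ℝ, 0 ≤ u → ∀ v : ℝ, ((F8 ((ε + u + v) / Real.sqrt 2, (ε + u - v) / Real.sqrt 2) : ℝ) : ℂ) =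
      ∫ p, cexp ((((-(u * p 0) : ℝ)) : ℂ) + ((v * p 1 : ℝ) : ℂ) * I) ∂μ :=
  fun ε hε => ⟨mu8 ε, isFiniteMeasure_mu8 hε, mu8_neg0 ε, mu8_cone ε,
    fun u hu v => by rw [F8_diag, integral_mu8 hε hu v]⟩

/-! ## The relaxed stub is false -/

/-- `stub_planarAngularRigidity` of line `transverse-smearing-planar-threshold` (lead skeleton v2,
2026-08-16) with its order hypothesis `σ < 8` RELAXED to `σ ≤ 8`; everything else verbatim. -/
def PlanarAngularRigidityLe8 : Prop :=
  ∀ (F : ℝ × ℝ → ℝ) (σ : ℝ), 0 < σ → σ ≤ 8 →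
    ContinuousOn F {x | x ≠ 0} →
    (∃ C : ℝ, ∀ x : ℝ × ℝ, x ≠ 0 → |F x| ≤ C * (1 + (x.1 ^ 2 + x.2 ^ 2) ^ (-(σ / 2)))) →
    (∀ t s : ℝ, F (t, s) = F (s, t) ∧ F (t, s) = F (t, -s) ∧ F (t, s) = F (-t, s)) →
    (∀ ε : ℝ, 0 < ε → ∃ μ : Measure (EuclideanSpace ℝ (Fin 4)), IsFiniteMeasure μ ∧
      μ {p | p 0 < 0} = 0 ∧ μ {p | p 0 < |p 1|} = 0 ∧
      ∀ t : ℝ, 0 ≤ t → ∀ b : ℝ, ((F (ε + t, b) : ℝ) : ℂ) =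
        ∫ p, cexp ((((-(t * p 0) : ℝ)) : ℂ) + ((b * p 1 : ℝ) : ℂ) * I) ∂μ) →
    (∀ ε : ℝ, 0 < ε → ∃ μ : Measure (EuclideanSpace ℝ (Fin 4)), IsFiniteMeasure μ ∧
      μ {p | p 0 < 0} = 0 ∧ μ {p | p 0 < |p 1|} = 0 ∧
      ∀ u : ℝ, 0 ≤ u → ∀ v : ℝ, ((F ((ε + u + v) / Real.sqrt 2, (ε + u - v) / Real.sqrt 2) : ℝ) : ℂ) =
        ∫ p, cexp ((((-(u * p 0) : ℝ)) : ℂ) + ((v * p 1 : ℝ) : ℂ) * I) ∂μ) →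
    ∀ r φ : ℝ, 0 < r → F (r * Real.cos φ, r * Real.sin φ) = F (r, 0)

/-- **The planar threshold is sharp**: `F₈ = cos(8φ)/r⁸` satisfies every hypothesis of
`stub_planarAngularRigidity` with `σ = 8` and is not radial, so `σ < 8` cannot be relaxed to `σ ≤ 8`
(and the type bound `e^{σ|Im φ|}` of the lead's Fourier-mode argument is attained by the modes `±2`).
[folklore] -/
theorem not_planarAngularRigidityLe8 : ¬ PlanarAngularRigidityLe8 := by
  intro h
  have key := h F8 8 (by norm_num) le_rfl continuousOn_F8 ⟨1, abs_F8_le⟩ F8_symm F8_axisRep F8_diagRep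
    1 (Real.pi / 8) one_pos
  rw [F8_dir_pi_div_eight, F8_one_zero] at key
  norm_num at key


end

end Summit.QuantumFields.YangMills.Theorems.ShellRigidity.Negative
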